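import Literature.NumberTheory.ComplexMultiplication.SexticOcticSlotFixedSide
import HarnessLib

/-!
# A sextic slot against an octic slot, IV: the trace along the element of order three; no two-dimensional
# common constituent

COR-CM (cell `pub-hodgecm2`, binder seat `b16` gen 47, count-neutral claim CM34-COMPLETE, file F4; theorems only, no
definition, no named fact, no `sorry`).  Setting of F1–F3: `G` acts on `X` (`|X| = 6`) and `Y` (`|Y| = 8`) with a
commuting conjugation `ρ`, and `c ∈ G` acts with `c³ = 1`, cycling the three pairs of `X` (frame `e : Fin 6 → X`) and,
on `Y`, fixing the pair `{y₀, ρy₀}` and cycling the three others (frame `e' : Fin 8 → Y`); `G` is transitive on `Y`.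
A common constituent is `(P, T)`: `P` a `G`-stable space of odd weights on `X`, `T` linear, equivariant and injective
on `P` with odd values.  Write `s(p) = p(x₀) + p(cx₀) + p(c²x₀)`, `a(q) = q(y₀)`, `S(q) = q(y₁) + q(cy₁) + q(c²y₁)`.

* §1 **`apply_eq_zero_and_sum_eq_zero_of_trace`** — for `p ∈ P` with `s(p) = 0`: `p + p∘c + p∘c² = 0`, hence
  `Tp + (Tp)∘c + (Tp)∘c² = 0`, i.e. `a(Tp) = 0` and `S(Tp) = 0` (the `ω`-isotypic parts for `⟨c⟩` correspond).
* §2 **`exists_mem_trace_eq_zero`** (`dim P ≥ 2` ⟹ some `p ≠ 0` in `P` has `s(p) = 0`),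
  **`linearIndependent_pair_comp`** (`p`, `p∘c` are then independent: a relation `λ³ = 1` over `ℚ` forces `p`
  constant on the `c`-orbit, hence `0`), **`exists_apply_translate_ne_zero`** (transitivity on `Y` moves a non-zero
  value of `Tp` to `y₀`: some `T(p∘g)` has `a ≠ 0`).
* §3 **`finrank_ne_two`** — a two-dimensional constituent is `span{p, p∘c}`, on which `s = 0`, so `a ∘ T = 0` on
  `P`; contradiction.  Hence (with F3) every common constituent is a line or all of the odd weights on `X`.

## References

* [Dodson1984] B. Dodson, *The structure of Galois groups of CM-fields*, Trans. AMS 283 (1984), §5.1.1–§5.1.2.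
* [Serre1977] J.-P. Serre, *Linear Representations of Finite Groups*, GTM 42, §2.6 (isotypic components).

Provenance: Literature home (namespace `Literature.NumberTheory.ComplexMultiplication.SexticOctic`) of the Summits-side `CorCM/SexticOcticSlotTrace` (cell `pub-hodgecm2`, COR-CM; all its imports are `Literature/`, Mathlib and the already re-homed `SexticOcticSlotFixedSide`), which `Literature/` may not import; theorems only, no named fact, no definition. Nothing here bears on `HC_CM`. Lane `lit-hodgefound` (Layer A3: CM types, their Kubota ranks and Galois combinatorics), seat p20.
-/

noncomputable section

namespace Literature.NumberTheory.ComplexMultiplication.SexticOctic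

open Literature.NumberTheory.ComplexMultiplication

variable {G : Type*} [Group G] {X Y : Type*} [MulAction G X] [MulAction G Y] {ρ : G}

/-! ## §0 Two bookkeeping lemmas -/

/-- The odd weights are `G`-stable (`G` commutes with `ρ`). [cite: Serre1977, §2.6] -/
theorem comp_smul_mem_antiWeights {Z : Type*} [MulAction G Z] (hcomm : ∀ (g : G) (z : Z), g • ρ • z = ρ • g • z)
    {f : Z → ℚ} (hf : f ∈ antiWeights (E := Z) ρ) (g : G) : (fun z => f (g • z)) ∈ antiWeights (E := Z) ρ := by
  rw [mem_antiWeights_iff'] at hf ⊢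
  intro z
  simp only [hcomm, hf]

/-- Equivariance twice: `T(p∘c²) = (Tp)∘c²` on `P`. [cite: Serre1977, §2.6] -/
theorem map_comp_comp {P : Submodule ℚ (X → ℚ)} (hPst : ∀ g : G, ∀ f ∈ P, (fun x => f (g • x)) ∈ P)
    (T : (X → ℚ) →ₗ[ℚ] (Y → ℚ)) (hT : ∀ g : G, ∀ f ∈ P, T (fun x => f (g • x)) = fun y => T f (g • y))
    (c : G) {p : X → ℚ} (hp : p ∈ P) :
    T (fun x => p (c • c • x)) = fun y => T p (c • c • y) := by
  have h1 : (fun x => p (c • c • x)) = fun x => (fun x' => p (c • x')) (c • x) := rfl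
  rw [h1, hT c _ (hPst c p hp), hT c p hp]

/-! ## §1 The trace along `c` -/

/-- **The `ω`-parts correspond.**  If `p ∈ P` has `p(x₀) + p(cx₀) + p(c²x₀) = 0` then `q = Tp` satisfies `q(y₀) = 0`
and `q(y₁) + q(cy₁) + q(c²y₁) = 0` (apply `T` to `p + p∘c + p∘c² = 0`). [cite: Serre1977, §2.6] -/
theorem apply_eq_zero_and_sum_eq_zero_of_trace {e : Fin 6 → X} (hsurj : Function.Surjective e)
    (hρe : ∀ i, ρ • e i = e (![3, 4, 5, 0, 1, 2] i)) {c : G} (hce : ∀ i, c • e i = e (![1, 2, 0, 4, 5, 3] i))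
    {e' : Fin 8 → Y} (hce' : ∀ i, c • e' i = e' (![0, 1, 3, 4, 2, 6, 7, 5] i))
    {P : Submodule ℚ (X → ℚ)} (hPanti : P ≤ antiWeights (E := X) ρ)
    (hPst : ∀ g : G, ∀ f ∈ P, (fun x => f (g • x)) ∈ P) (T : (X → ℚ) →ₗ[ℚ] (Y → ℚ))
    (hT : ∀ g : G, ∀ f ∈ P, T (fun x => f (g • x)) = fun y => T f (g • y))
    {p : X → ℚ} (hp : p ∈ P) (hs : p (e 0) + p (e 1) + p (e 2) = 0) :
    T p (e' 0) = 0 ∧ T p (e' 2) + T p (e' 3) + T p (e' 4) = 0 := by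
  have h0 := add_comp_add_comp_eq_zero₆ hsurj hρe hce (hPanti hp) hs
  have h1 : (T p + (fun y => T p (c • y)) + fun y => T p (c • c • y)) = 0 := by
    rw [← hT c p hp, ← map_comp_comp hPst T hT c hp, ← map_add, ← map_add, h0, map_zero]
  exact apply_eq_zero_of_add_comp_add_comp_eq_zero₈ hce' h1

/-! ## §2 A traceless vector, its independence from its `c`-translate, and a translate with `a ≠ 0` -/

/-- **`dim P ≥ 2` ⟹ some `p ≠ 0` in `P` has `p(x₀) + p(cx₀) + p(c²x₀) = 0`.** [cite: Serre1977, §2.6] -/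
theorem exists_mem_trace_eq_zero (e : Fin 6 → X) {P : Submodule ℚ (X → ℚ)} (h2 : 2 ≤ Module.finrank ℚ P) :
    ∃ p ∈ P, p ≠ 0 ∧ p (e 0) + p (e 1) + p (e 2) = 0 :=
  exists_mem_ne_zero_map_eq_zero h2
    (LinearMap.proj (R := ℚ) (φ := fun _ : X => ℚ) (e 0) + LinearMap.proj (R := ℚ) (φ := fun _ : X => ℚ) (e 1) +
      LinearMap.proj (R := ℚ) (φ := fun _ : X => ℚ) (e 2))

/-- **A non-zero traceless odd weight and its `c`-translate are linearly independent**: a relation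
`a·p + b·(p∘c) = 0` gives `(a³ + b³)·p = 0` on the frame; `a³ + b³ = 0` forces `a = −b` and then `p` constant on
`x₀, cx₀, c²x₀`, i.e. `p = 0`. [cite: Serre1977, §2.6] -/
theorem linearIndependent_pair_comp {e : Fin 6 → X} (hsurj : Function.Surjective e)
    (hρe : ∀ i, ρ • e i = e (![3, 4, 5, 0, 1, 2] i)) {c : G} (hce : ∀ i, c • e i = e (![1, 2, 0, 4, 5, 3] i))
    {p : X → ℚ} (hp : p ∈ antiWeights (E := X) ρ) (hp0 : p ≠ 0) (hs : p (e 0) + p (e 1) + p (e 2) = 0) :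
    LinearIndependent ℚ ![p, fun x => p (c • x)] := by
  rw [LinearIndependent.pair_iff]
  intro a b hab
  have hev : ∀ i : Fin 6, a * p (e i) + b * p (c • e i) = 0 := fun i => by
    have := congrFun hab (e i)
    simpa using this
  have h1 := hev 0
  have h2 := hev 1
  have h3 := hev 2
  rw [hce] at h1 h2 h3
  simp only [Matrix.cons_val] at h1 h2 h3
  -- `(a³ + b³) pᵢ = 0`
  have k0 : (a ^ 3 + b ^ 3) * p (e 0) = 0 := by linear_combination a ^ 2 * h1 - a * b * h2 + b ^ 2 * h3
  have k1 : (a ^ 3 + b ^ 3) * p (e 1) = 0 := by linear_combination a ^ 2 * h2 - a * b * h3 + b ^ 2 * h1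
  have k2 : (a ^ 3 + b ^ 3) * p (e 2) = 0 := by linear_combination a ^ 2 * h3 - a * b * h1 + b ^ 2 * h2
  have hne : ¬ (p (e 0) = 0 ∧ p (e 1) = 0 ∧ p (e 2) = 0) := fun h =>
    hp0 (eq_zero_of_frame₆ hsurj hρe hp h.1 h.2.1 h.2.2)
  by_cases hab3 : a ^ 3 + b ^ 3 = 0
  · have hab' : a = -b :=
      (Odd.strictMono_pow (by decide : Odd 3)).injective (by linear_combination hab3)
    subst hab'
    by_cases hb : b = 0
    · exact ⟨by simp [hb], hb⟩
    · exfalso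
      apply hne
      have e01 : p (e 1) = p (e 0) := by
        have : b * (p (e 1) - p (e 0)) = 0 := by linear_combination h1
        simpa [hb, sub_eq_zero] using this
      have e12 : p (e 2) = p (e 1) := by
        have : b * (p (e 2) - p (e 1)) = 0 := by linear_combination h2
        simpa [hb, sub_eq_zero] using this
      refine ⟨by linarith, by linarith, by linarith⟩
  · exfalso
    apply hne
    exact ⟨(mul_eq_zero.1 k0).resolve_left hab3, (mul_eq_zero.1 k1).resolve_left hab3,
      (mul_eq_zero.1 k2).resolve_left hab3⟩

/-- **Transitivity on `Y` moves a non-zero value to `y₀`**: if `q = Tp ≠ 0` (`p ∈ P`), then some translate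
`T(p∘g) = q∘g` does not vanish at `y₀`. [cite: Serre1977, §2.6] -/
theorem exists_apply_translate_ne_zero [MulAction.IsPretransitive G Y] {e' : Fin 8 → Y}
    (hsurj' : Function.Surjective e') {P : Submodule ℚ (X → ℚ)} (T : (X → ℚ) →ₗ[ℚ] (Y → ℚ))
    (hT : ∀ g : G, ∀ f ∈ P, T (fun x => f (g • x)) = fun y => T f (g • y))
    (hTinj : ∀ f ∈ P, T f = 0 → f = 0) {p : X → ℚ} (hp : p ∈ P) (hp0 : p ≠ 0) :
    ∃ g : G, T (fun x => p (g • x)) (e' 0) ≠ 0 := by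
  have hq0 : T p ≠ 0 := fun h => hp0 (hTinj p hp h)
  obtain ⟨j, hj⟩ : ∃ j : Fin 8, T p (e' j) ≠ 0 := by
    by_contra hall
    push Not at hall
    exact hq0 (eq_zero_of_forall_frame hsurj' hall)
  obtain ⟨g, hg⟩ := MulAction.exists_smul_eq G (e' 0) (e' j)
  refine ⟨g, ?_⟩
  rw [hT g p hp]
  simpa only [hg] using hj

/-! ## §3 No two-dimensional common constituent -/

/-- **A common constituent is never two-dimensional.**  If `dim P = 2` then `P = span{p, p∘c}` for a traceless
`p`, so every `f ∈ P` is traceless and every `Tf` vanishes at `y₀`; but some translate `T(p∘g)` does not.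
[cite: Serre1977, §2.6] [cite: Dodson1984, §5.1.1] -/
theorem finrank_ne_two [MulAction.IsPretransitive G Y] {e : Fin 6 → X} (hsurj : Function.Surjective e)
    (hρe : ∀ i, ρ • e i = e (![3, 4, 5, 0, 1, 2] i)) {c : G} (hce : ∀ i, c • e i = e (![1, 2, 0, 4, 5, 3] i))
    {e' : Fin 8 → Y} (hsurj' : Function.Surjective e') (hce' : ∀ i, c • e' i = e' (![0, 1, 3, 4, 2, 6, 7, 5] i))
    {P : Submodule ℚ (X → ℚ)} (hPanti : P ≤ antiWeights (E := X) ρ)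
    (hPst : ∀ g : G, ∀ f ∈ P, (fun x => f (g • x)) ∈ P) (T : (X → ℚ) →ₗ[ℚ] (Y → ℚ))
    (hT : ∀ g : G, ∀ f ∈ P, T (fun x => f (g • x)) = fun y => T f (g • y))
    (hTinj : ∀ f ∈ P, T f = 0 → f = 0) : Module.finrank ℚ P ≠ 2 := by
  intro h2
  obtain ⟨p, hpP, hp0, hs⟩ := exists_mem_trace_eq_zero e (P := P) (by omega)
  have hli := linearIndependent_pair_comp hsurj hρe hce (hPanti hpP) hp0 hs
  -- `P = span {p, p∘c}`
  have hle : Submodule.span ℚ (Set.range ![p, fun x => p (c • x)]) ≤ P := by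
    rw [Submodule.span_le]
    rintro _ ⟨i, rfl⟩
    fin_cases i
    · exact hpP
    · exact hPst c p hpP
  haveI : FiniteDimensional ℚ P := Module.finite_of_finrank_pos (by omega)
  have heq : Submodule.span ℚ (Set.range ![p, fun x => p (c • x)]) = P :=
    Submodule.eq_of_le_of_finrank_eq hle (by rw [finrank_span_eq_card hli, h2]; rfl)
  -- every `f ∈ P` is traceless, hence `T f (y₀) = 0`
  have htr : ∀ f ∈ P, f (e 0) + f (e 1) + f (e 2) = 0 := by
    intro f hf
    rw [← heq, Submodule.mem_span_range_iff_exists_fun] at hf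
    obtain ⟨k, rfl⟩ := hf
    have hsc : p (c • e 0) + p (c • e 1) + p (c • e 2) = 0 := by rw [sum_comp_eq_sum₆ hce]; exact hs
    simp only [Fin.sum_univ_two, Matrix.cons_val_zero, Matrix.cons_val_one, Pi.add_apply,
      Pi.smul_apply, smul_eq_mul]
    linear_combination k 0 * hs + k 1 * hsc
  obtain ⟨g, hg⟩ := exists_apply_translate_ne_zero hsurj' T hT hTinj hpP hp0
  exact hg (apply_eq_zero_and_sum_eq_zero_of_trace hsurj hρe hce hce' hPanti hPst T hT (hPst g p hpP)
    (htr _ (hPst g p hpP))).1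

end Literature.NumberTheory.ComplexMultiplication.SexticOctic

end
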